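import Literature.AnabelianGeometry.SemiGraphs.PSCCoveringDatumProofs
import Literature.AnabelianGeometry.SemiGraphs.PSCRamification
import Mathlib.Tactic.Group
import HarnessLib

/-!
# The covering datum `G_U`: the unramified quotient and verticially purely totally ramified coverings

PROOF-ONLY companion of abc-iut-L3-t4's `PSCCoveringDatum.lean` / `PSCCoveringDatumProofs.lean`
([CombGC] Def. 1.1 (ii), Mochizuki, *A combinatorial version of the Grothendieck conjecture*, Tohoku
Math. J. **59** (2007), author's ms pp. 6–7), written for the cell's sub-DAG row CombGC:Thm1.6(iii)/
T16-L16 (abc-iut-w5-d174): [IUTchI] Remark 1.2.3 (vii) (kurims p. 43) proves necessity in [CombGC]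
Thm. 1.6 (iii) "formally from … the characterization of verticially purely totally ramified finite
étale coverings given in Remark 1.4.2", where Remark 1.4.2 ([IUTchI] Rmk. 1.2.3 (iii)) is applied not
only to `G` but FUNCTORIALLY, to every finite étale `Π^unr_G`-covering `G_U`.  The landed assembly
`PSCUnrVerticialNecessityProofs` therefore carries, as an explicit binder (GAP-LEDGER G-w5d174-2), the
statement of abc-iut-L3-t4's typed `VerticialPureRamificationCount` for the covering `G_U` written in
the vocabulary of `G` (counts `nodeCount`/`vertCount` of `G`, `relIndex`,
`IsVerticiallyPurelyTotallyRamified U H'`).  This file proves that binder from the typed predicate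
APPLIED TO THE COVERING DATUM, `(G.restrict U hU).VerticialPureRamificationCount`:

* `map_subtype_unrKer_restrict` — `Ker(Π_{G_U} ↠ Π^unr_{G_U}) = Ker(Π_G ↠ Π^unr_G)` for a
  `Π^unr_G`-covering `G_U` (`U ⊇ Ker` open of finite index): the edge-like subgroups of `Π_{G_U} = U`
  are the traces of those of `Π_G`, all of which lie in `U`;
* `isVerticiallyPurelyTotallyRamified_restrict_iff` — for `H' ⊆ U`, the covering `G_{H'} → G_U` is
  verticially purely totally ramified in the sense of Def. 1.4 (v) applied to the datum `G_U` (at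
  its trivial level) iff it is so in the sense of abc-iut-L3-t4's level-`U` predicate
  `G.IsVerticiallyPurelyTotallyRamified U H'` (vertices `(v, U y Π_v)` of `G_U` with `U`-conjugators
  ↔ pairs `(v, γ ∈ Π_G)` via `γ = u · y · p`);
* `verticialPureRamificationCount_level_of_restrict` — Rmk. 1.4.2 for the datum `G_U` yields the
  level-`U` statement consumed by `PSCUnrVerticialNecessityProofs` (binder `hRC`).

Pure group theory over the interface; 0 defs; nothing here takes a side on [IUTchIII] Cor. 3.12.
[cite: MochizukiCombGC2007, Def 1.1(ii) pp.6-7] [cite: MochizukiCombGC2007, Rmk 1.4.2 p.11]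
-/

noncomputable section

namespace Literature.AnabelianGeometry.SemiGraphs

namespace PSCDatum

open scoped Pointwise
open PSCCovering

universe u

variable {P : Type u} [Group P] [TopologicalSpace P] [IsTopologicalGroup P] (G : PSCDatum P)
  (U : Subgroup P) [U.FiniteIndex] (hU : IsOpen (U : Set P))

/-! ### 1. `Ker(Π_{G_U} ↠ Π^unr_{G_U}) = Ker(Π_G ↠ Π^unr_G)` for `Π^unr_G`-coverings -/

omit [TopologicalSpace P] [IsTopologicalGroup P] in
/-- A `Π_G`-conjugate of an element of `K` is a `U`-conjugate of an element of the trace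
`U ∩ y_i K y_i⁻¹` of the representative conjugate attached to its double coset — granted that all
conjugates of `K` lie in `U`. [cite: MochizukiCombGC2007, Def 1.1(ii) p.6] -/
private theorem conj_mem_map_normalClosure {K : Subgroup P} {S : Set U}
    (hS : ∀ i : dcFin U K, (((ConjAct.toConjAct (dcRep U K i) • K).subgroupOf U : Subgroup U) :
      Set U) ⊆ S)
    (hKU : ∀ g : P, ConjAct.toConjAct g • K ≤ U) {g p : P} (hp : p ∈ K) :
    g * p * g⁻¹ ∈ (Subgroup.normalClosure S).map U.subtype := by
  obtain ⟨u, hu, k, hk, hrep⟩ := exists_dcRep_dcIdx_eq U K g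
  set y := dcRep U K (dcIdx U K g) with hy
  -- `g = u⁻¹ y k⁻¹`, so `g p g⁻¹ = u⁻¹ (y (k⁻¹ p k) y⁻¹) u`
  have hp' : k⁻¹ * p * k ∈ K := K.mul_mem (K.mul_mem (K.inv_mem hk) hp) hk
  have ha : y * (k⁻¹ * p * k) * y⁻¹ ∈ ConjAct.toConjAct y • K :=
    (Subgroup.mem_smul_pointwise_iff_exists _ _ _).mpr ⟨_, hp', by rw [ConjAct.smul_def,
      ConjAct.ofConjAct_toConjAct]⟩
  have haU : y * (k⁻¹ * p * k) * y⁻¹ ∈ U := hKU y ha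
  have haS : (⟨_, haU⟩ : U) ∈ Subgroup.normalClosure S :=
    Subgroup.subset_normalClosure (hS _ (by
      rw [SetLike.mem_coe, Subgroup.mem_subgroupOf]; exact ha))
  have hconj : (⟨u, hu⟩⁻¹ * ⟨_, haU⟩ * (⟨u, hu⟩⁻¹)⁻¹ : U) ∈ Subgroup.normalClosure S :=
    (Subgroup.normalClosure_normal (s := S)).conj_mem _ haS _
  refine ⟨_, hconj, ?_⟩
  have hg : g = u⁻¹ * y * k⁻¹ := by
    rw [hrep]; group
  simp only [Subgroup.coe_subtype, Subgroup.coe_mul, Subgroup.coe_inv, inv_inv, hg]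
  group

/-- The normal closure in `U` of the edge-like subgroups of the datum `G_U` maps onto the normal
closure in `Π_G` of the edge-like subgroups of `G`, granted the latter lies in `U`.
[cite: MochizukiCombGC2007, Def 1.1(ii) p.7] -/
theorem map_subtype_normalClosure_edges_restrict
    (hKU : Subgroup.normalClosure ((⋃ c, (G.cuspGp c : Set P)) ∪ ⋃ e, (G.nodeGp e : Set P)) ≤ U) :
    (Subgroup.normalClosure ((⋃ d, ((G.restrict U hU).cuspGp d : Set U)) ∪
        ⋃ d, ((G.restrict U hU).nodeGp d : Set U))).map U.subtype =
      Subgroup.normalClosure ((⋃ c, (G.cuspGp c : Set P)) ∪ ⋃ e, (G.nodeGp e : Set P)) := by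
  set S : Set U := (⋃ d, ((G.restrict U hU).cuspGp d : Set U)) ∪
    ⋃ d, ((G.restrict U hU).nodeGp d : Set U) with hSdef
  set T : Set P := (⋃ c, (G.cuspGp c : Set P)) ∪ ⋃ e, (G.nodeGp e : Set P) with hTdef
  haveI : ((Subgroup.normalClosure T).subgroupOf U).Normal := inferInstance
  refine le_antisymm ?_ ?_
  · -- `S ⊆ (normalClosure T) ∩ U`
    rw [Subgroup.map_le_iff_le_comap]
    refine Subgroup.normalClosure_le_normal fun a ha => ?_
    rw [SetLike.mem_coe, Subgroup.mem_comap, Subgroup.coe_subtype]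
    rcases ha with ha | ha
    · obtain ⟨d, hd⟩ := Set.mem_iUnion.mp ha
      rw [SetLike.mem_coe, restrict_cuspGp, Subgroup.mem_subgroupOf,
        Subgroup.mem_smul_pointwise_iff_exists] at hd
      obtain ⟨p, hp, hpa⟩ := hd
      rw [← hpa, ConjAct.smul_def, ConjAct.ofConjAct_toConjAct]
      have hpT : p ∈ Subgroup.normalClosure T :=
        Subgroup.subset_normalClosure (Or.inl (Set.mem_iUnion.mpr ⟨d.1, hp⟩))
      exact (Subgroup.normalClosure_normal (s := T)).conj_mem _ hpT _
    · obtain ⟨d, hd⟩ := Set.mem_iUnion.mp ha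
      rw [SetLike.mem_coe, restrict_nodeGp, Subgroup.mem_subgroupOf,
        Subgroup.mem_smul_pointwise_iff_exists] at hd
      obtain ⟨p, hp, hpa⟩ := hd
      rw [← hpa, ConjAct.smul_def, ConjAct.ofConjAct_toConjAct]
      have hpT : p ∈ Subgroup.normalClosure T :=
        Subgroup.subset_normalClosure (Or.inr (Set.mem_iUnion.mpr ⟨d.1, hp⟩))
      exact (Subgroup.normalClosure_normal (s := T)).conj_mem _ hpT _
  · -- every conjugate of an edge-group element is in the image
    change Subgroup.closure (Group.conjugatesOfSet T) ≤ _
    rw [Subgroup.closure_le]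
    intro x hx
    obtain ⟨p, hp, hpx⟩ := Group.mem_conjugatesOfSet_iff.mp hx
    obtain ⟨g, rfl⟩ := isConj_iff.mp hpx
    have hconjU : ∀ (K : Subgroup P), (K : Set P) ⊆ T → ∀ g : P, ConjAct.toConjAct g • K ≤ U := by
      intro K hK g a ha
      obtain ⟨b, hb, rfl⟩ := (Subgroup.mem_smul_pointwise_iff_exists _ _ _).mp ha
      rw [ConjAct.smul_def, ConjAct.ofConjAct_toConjAct]
      exact hKU ((Subgroup.normalClosure_normal (s := T)).conj_mem _
        (Subgroup.subset_normalClosure (hK hb)) _)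
    rcases hp with hp | hp
    · obtain ⟨c, hc⟩ := Set.mem_iUnion.mp hp
      refine conj_mem_map_normalClosure U (K := G.cuspGp c) (fun i => ?_)
        (hconjU _ (fun a ha => Or.inl (Set.mem_iUnion.mpr ⟨c, ha⟩))) hc
      intro a ha
      exact Or.inl (Set.mem_iUnion.mpr ⟨⟨c, i⟩, ha⟩)
    · obtain ⟨e, he⟩ := Set.mem_iUnion.mp hp
      refine conj_mem_map_normalClosure U (K := G.nodeGp e) (fun i => ?_)
        (hconjU _ (fun a ha => Or.inr (Set.mem_iUnion.mpr ⟨e, ha⟩))) he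
      intro a ha
      exact Or.inr (Set.mem_iUnion.mpr ⟨⟨e, i⟩, ha⟩)

variable {G U} in
omit [U.FiniteIndex] in
/-- Topological closure commutes with the closed embedding `U ↪ Π_G` (`U` open, hence closed).
[cite: MochizukiCombGC2007, Def 1.1(ii) p.6] -/
theorem map_subtype_topologicalClosure_of_isOpen (hU : IsOpen (U : Set P)) (A : Subgroup U) :
    (A.topologicalClosure).map U.subtype = (A.map U.subtype).topologicalClosure := by
  apply SetLike.coe_injective
  simp only [Subgroup.coe_map, Subgroup.topologicalClosure_coe, Subgroup.coe_subtype]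
  exact ((Subgroup.isClosed_of_isOpen U hU).isClosedEmbedding_subtypeVal.closure_image_eq _).symm

/-- **`Ker(Π_{G_U} ↠ Π^unr_{G_U}) = Ker(Π_G ↠ Π^unr_G)`** for a `Π^unr_G`-covering `G_U` (`U ⊇ Ker`
open of finite index): "a finite étale `Π^unr_G`-covering … arises from an open subgroup of `Π^unr_G`"
(Def. 1.1 (ii), p. 7), so `Π^unr_{G_U} = U / Ker`. [cite: MochizukiCombGC2007, Def 1.1(ii) p.7] -/
theorem map_subtype_unrKer_restrict (hKU : G.unrKer ≤ U) :
    ((G.restrict U hU).unrKer).map U.subtype = G.unrKer := by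
  unfold unrKer
  rw [map_subtype_topologicalClosure_of_isOpen hU, G.map_subtype_normalClosure_edges_restrict U hU
    ((Subgroup.le_topologicalClosure _).trans hKU)]

/-- The same, as subgroups of `U`: `Ker(Π_{G_U} ↠ Π^unr_{G_U})` is the trace of `Ker(Π_G ↠ Π^unr_G)`.
[cite: MochizukiCombGC2007, Def 1.1(ii) p.7] -/
theorem unrKer_restrict (hKU : G.unrKer ≤ U) :
    (G.restrict U hU).unrKer = G.unrKer.subgroupOf U := by
  rw [eq_subgroupOf_iff_map_eq, G.map_subtype_unrKer_restrict U hU hKU, eq_comm, inf_eq_right]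
  exact hKU

/-! ### 2. Verticially purely totally ramified: the datum `G_U` at its trivial level vs. the level-`U` predicate -/

section VPTR

variable {G U}

/-- The conjugate `δ • Π_w` of the representative verticial subgroup of `G_U` at `w = U y Π_v` by
`δ ∈ U` is, inside `Π_G`, the trace `U ∩ (δ y) Π_v (δ y)⁻¹`. [cite: MochizukiCombGC2007, Def 1.1(ii) p.6] -/
theorem map_subtype_smul_restrict_vertGp (hU : IsOpen (U : Set P)) (w : (G.restrictGraph U).V)
    (δ : ConjAct U) :
    (δ • (G.restrict U hU).vertGp w).map U.subtype =
      U ⊓ ConjAct.toConjAct (((ConjAct.ofConjAct δ : U) : P) * G.vrep U w) • G.vertGp w.1 := by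
  rw [restrict_vertGp, ← ConjAct.toConjAct_ofConjAct δ, conj_subgroupOf_eq, ConjAct.toConjAct_ofConjAct,
    ← mul_smul, ← map_mul, Subgroup.subgroupOf_map_subtype, inf_comm]

omit [IsTopologicalGroup P] in
/-- The vertex of `G_U` over `v` through `u · y_w` (`u ∈ U`) is `w`. [cite: MochizukiCombGC2007, Def 1.1(ii) p.6] -/
theorem dcIdx_mul_vrep {u : P} (hu : u ∈ U) (v : G.graph.V) (j : dcFin U (G.vertGp v)) :
    dcIdx U (G.vertGp v) (u * G.vrep U ⟨v, j⟩) = j := by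
  have h1 : dcIdx U (G.vertGp v) (u * G.vrep U ⟨v, j⟩) = dcIdx U (G.vertGp v) (G.vrep U ⟨v, j⟩) :=
    (dcIdx_eq_iff U (G.vertGp v)).mpr ⟨u⁻¹, U.inv_mem hu, 1, (G.vertGp v).one_mem, by group⟩
  rw [h1]
  exact dcIdx_dcRep U (G.vertGp v) j

/-- Every trace `U ∩ γ Π_v γ⁻¹` is the image of a conjugate `δ • Π_w` of a representative verticial
subgroup of `G_U`, with `w` the vertex of `G_U` over `v` through `γ`.
[cite: MochizukiCombGC2007, Def 1.1(ii) p.6] -/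
theorem exists_smul_restrict_vertGp_map_eq (hU : IsOpen (U : Set P)) (v : G.graph.V) (γ : ConjAct P) :
    ∃ δ : ConjAct U, (δ • (G.restrict U hU).vertGp ⟨v, dcIdx U (G.vertGp v) (ConjAct.ofConjAct γ)⟩).map
        U.subtype = U ⊓ γ • G.vertGp v := by
  obtain ⟨u, hu, k, hk, hrep⟩ := exists_dcRep_dcIdx_eq U (G.vertGp v) (ConjAct.ofConjAct γ)
  refine ⟨ConjAct.toConjAct (⟨u, hu⟩⁻¹ : U), ?_⟩
  rw [map_subtype_smul_restrict_vertGp, ConjAct.ofConjAct_toConjAct, Subgroup.coe_inv, Subgroup.coe_mk]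
  congr 1
  change ConjAct.toConjAct (u⁻¹ * dcRep U (G.vertGp v) (dcIdx U (G.vertGp v) (ConjAct.ofConjAct γ))) •
    G.vertGp v = γ • G.vertGp v
  rw [hrep, show u⁻¹ * (u * ConjAct.ofConjAct γ * k) = ConjAct.ofConjAct γ * k by group, map_mul,
    mul_smul, ConjAct.toConjAct_ofConjAct]
  congr 1
  ext b
  rw [Subgroup.mem_pointwise_smul_iff_inv_smul_mem, ← ConjAct.toConjAct_inv, ConjAct.smul_def,
    ConjAct.ofConjAct_toConjAct, inv_inv]
  constructor
  · intro hb
    have hb' := (G.vertGp v).mul_mem ((G.vertGp v).mul_mem hk hb) ((G.vertGp v).inv_mem hk)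
    rwa [show k * (k⁻¹ * b * k) * k⁻¹ = b by group] at hb'
  · exact fun hb => (G.vertGp v).mul_mem ((G.vertGp v).mul_mem ((G.vertGp v).inv_mem hk) hb) hk

omit [IsTopologicalGroup P] [U.FiniteIndex] in
/-- Openness of `H' ⊆ U` in `Π_G` vs. in `U` (`U` open). [cite: MochizukiCombGC2007, Def 1.1(ii) p.6] -/
theorem isOpen_subgroupOf_iff (hU : IsOpen (U : Set P)) {H' : Subgroup P} (hH'U : H' ≤ U) :
    IsOpen ((H'.subgroupOf U : Subgroup U) : Set U) ↔ IsOpen (H' : Set P) := by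
  constructor
  · intro h
    have e : (H' : Set P) = Subtype.val '' ((H'.subgroupOf U : Subgroup U) : Set U) := by
      ext x
      simp only [Set.mem_image, SetLike.mem_coe, Subgroup.mem_subgroupOf, Subtype.exists,
        exists_and_right, exists_eq_right]
      exact ⟨fun hx => ⟨hH'U hx, hx⟩, fun ⟨_, hx⟩ => hx⟩
    rw [e]
    exact hU.isOpenMap_subtype_val _ h
  · intro h
    exact h.preimage continuous_subtype_val

omit [TopologicalSpace P] [IsTopologicalGroup P] [U.FiniteIndex] in
/-- Normality of `H' ⊆ U` in `U`: datum form vs. interface form. [cite: MochizukiCombGC2007, Def 1.4(v) p.11] -/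
theorem subgroupOf_top_normal_iff {H' : Subgroup P} (hH'U : H' ≤ U) :
    (((H'.subgroupOf U).subgroupOf (⊤ : Subgroup U)).Normal) ↔ (H'.subgroupOf U).Normal := by
  rw [Subgroup.normal_subgroupOf_iff le_top, Subgroup.normal_subgroupOf_iff hH'U]
  constructor
  · intro h a k ha hk
    have := h ⟨a, hH'U ha⟩ ⟨k, hk⟩ (by rw [Subgroup.mem_subgroupOf]; exact ha) (Subgroup.mem_top _)
    rw [Subgroup.mem_subgroupOf] at this
    exact this
  · intro h a k ha _
    rw [Subgroup.mem_subgroupOf] at ha ⊢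
    exact h a k ha k.2

omit [IsTopologicalGroup P] [U.FiniteIndex] in
/-- Galois coverings: `G_{H'} → G_U` is Galois as a covering of the datum `G_U` (at the trivial level)
iff it is Galois in the interface's two-level sense. [cite: MochizukiCombGC2007, Def 1.4(v) p.11] -/
theorem isGaloisCovering_subgroupOf_top_iff (hU : IsOpen (U : Set P)) {H' : Subgroup P}
    (hH'U : H' ≤ U) :
    IsGaloisCovering (⊤ : Subgroup U) (H'.subgroupOf U) ↔ IsGaloisCovering U H' := by
  unfold IsGaloisCovering
  rw [isOpen_subgroupOf_iff hU hH'U, subgroupOf_top_normal_iff hH'U]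
  simp only [le_top, true_and, hH'U, Subgroup.coe_top, isOpen_univ, hU]

/-- **`G_{H'} → G_U` is verticially purely totally ramified as a covering of the datum `G_U` iff it is
so in the interface's level-`U` sense** (`H' ⊆ U`): Def. 1.4 (v) applied to the covering datum agrees
with abc-iut-L3-t4's two-level predicate `IsVerticiallyPurelyTotallyRamified U H'`.
[cite: MochizukiCombGC2007, Def 1.4(v) p.11] -/
theorem isVerticiallyPurelyTotallyRamified_restrict_iff (hU : IsOpen (U : Set P)) {H' : Subgroup P}
    (hH'U : H' ≤ U) :
    (G.restrict U hU).IsVerticiallyPurelyTotallyRamified ⊤ (H'.subgroupOf U) ↔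
      G.IsVerticiallyPurelyTotallyRamified U H' := by
  have hinj : Function.Injective (Subgroup.map U.subtype) := Subgroup.map_injective U.subtype_injective
  have hmapH' : (H'.subgroupOf U).map U.subtype = H' := by
    rw [Subgroup.subgroupOf_map_subtype, inf_eq_left.mpr hH'U]
  have hmapU : (⊤ : Subgroup U).map U.subtype = U := by
    rw [← MonoidHom.range_eq_map, Subgroup.range_subtype]
  -- the universal double coset at the trivial level
  have huniv : ∀ (w : (G.restrictGraph U).V) (δ δ' : ConjAct U),
      ConjAct.ofConjAct δ' ∈ DoubleCoset.doubleCoset (ConjAct.ofConjAct δ)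
        ((⊤ : Subgroup U) : Set U) (((G.restrict U hU).vertGp w : Subgroup U) : Set U) := by
    intro w δ δ'
    rw [DoubleCoset.mem_doubleCoset]
    exact ⟨ConjAct.ofConjAct δ' * (ConjAct.ofConjAct δ)⁻¹, Subgroup.mem_top _, 1, Subgroup.one_mem _,
      by group⟩
  unfold IsVerticiallyPurelyTotallyRamified
  rw [isGaloisCovering_subgroupOf_top_iff hU hH'U]
  refine and_congr_right fun _ => ⟨?_, ?_⟩
  · rintro ⟨⟨w1, w2⟩, δ, htot, htriv⟩
    refine ⟨w1, ConjAct.toConjAct (((ConjAct.ofConjAct δ : U) : P) * G.vrep U ⟨w1, w2⟩), ?_, ?_⟩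
    · have := congrArg (Subgroup.map U.subtype) htot
      rwa [Subgroup.map_sup, top_inf_eq, map_subtype_smul_restrict_vertGp, hmapH', hmapU] at this
    · intro v' γ' hne
      obtain ⟨δ', hδ'⟩ := exists_smul_restrict_vertGp_map_eq hU v' γ'
      have hww' : (⟨v', dcIdx U (G.vertGp v') (ConjAct.ofConjAct γ')⟩ : (G.restrictGraph U).V) ≠
          ⟨w1, w2⟩ := by
        intro h
        obtain ⟨h1, h2⟩ := Sigma.mk.inj_iff.mp h
        subst h1
        have h2' := eq_of_heq h2
        rcases hne with hne | hne
        · exact hne rfl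
        · apply hne
          rw [ConjAct.ofConjAct_toConjAct, DoubleCoset.mem_doubleCoset]
          have hidx : dcIdx U (G.vertGp v') (((ConjAct.ofConjAct δ : U) : P) * G.vrep U ⟨v', w2⟩) =
              dcIdx U (G.vertGp v') (ConjAct.ofConjAct γ') := by
            rw [dcIdx_mul_vrep (ConjAct.ofConjAct δ).2 v' w2, h2']
          exact (dcIdx_eq_iff U _).mp hidx
      have h2 := htriv _ δ' (Or.inl hww')
      rw [top_inf_eq] at h2
      have := Subgroup.map_mono (f := U.subtype) h2
      rwa [hδ', hmapH'] at this
  · rintro ⟨v, γ, htot, htriv⟩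
    obtain ⟨δ, hδ⟩ := exists_smul_restrict_vertGp_map_eq hU v γ
    refine ⟨⟨v, dcIdx U (G.vertGp v) (ConjAct.ofConjAct γ)⟩, δ, ?_, ?_⟩
    · apply hinj
      rw [Subgroup.map_sup, top_inf_eq, hδ, hmapH', hmapU, htot]
    · rintro ⟨v', j'⟩ δ' hne
      have hne' : (⟨v', j'⟩ : (G.restrictGraph U).V) ≠
          ⟨v, dcIdx U (G.vertGp v) (ConjAct.ofConjAct γ)⟩ := by
        rcases hne with hne | hne
        · exact hne
        · exact absurd (huniv _ δ δ') hne
      rw [top_inf_eq, ← Subgroup.map_le_map_iff_of_injective U.subtype_injective, hmapH',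
        map_subtype_smul_restrict_vertGp]
      refine htriv v' _ ?_
      by_cases hv : v' = v
      · subst hv
        right
        rw [ConjAct.ofConjAct_toConjAct, DoubleCoset.mem_doubleCoset]
        rintro ⟨x, hx, y, hy, hxy⟩
        apply hne'
        have : j' = dcIdx U (G.vertGp v') (ConjAct.ofConjAct γ) := by
          rw [← dcIdx_mul_vrep (G := G) (ConjAct.ofConjAct δ').2 v' j', hxy]
          exact (dcIdx_eq_iff U (G.vertGp v')).mpr
            ⟨x⁻¹, U.inv_mem hx, y⁻¹, (G.vertGp v').inv_mem hy, by group⟩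
        rw [this]
      · exact Or.inl hv

end VPTR

/-! ### 3. [CombGC] Rmk. 1.4.2 for the covering datum `G_U` ⇒ the level-`U` statement -/

section Rmk142

variable {G U}

/-- **[CombGC] Rmk. 1.4.2 (second display) / [IUTchI] Rmk. 1.2.3 (iii) for the covering datum `G_U`
yields its level-`U` form in the vocabulary of `G`** — the binder `hRC` of
`PSCUnrVerticialNecessityProofs` (GAP-LEDGER G-w5d174-2) at the level `U`: for a Galois sub-covering
`G_{H'} → G_U` of degree `l^k`, `k > 0`, which is a `Π^unr`-covering, `n(G_{H'}) = [U:H']·n(G_U)` and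
"`G_{H'} → G_U` is verticially purely totally ramified iff `i(G_{H'}) = [U:H']·(i(G_U) − 1) + 1`".
Inputs: abc-iut-L3-t4's typed `VerticialPureRamificationCount` APPLIED TO `G.restrict U hU`, the count
transfer `restrict_nodeCount` / `restrict_vertCount` / `restrict_graph_n` / `restrict_graph_i`
(abc-iut-L3-t4) and §§1–2 above. [cite: MochizukiCombGC2007, Rmk 1.4.2 p.11] -/
theorem verticialPureRamificationCount_level_of_restrict (hU : IsOpen (U : Set P))
    (hKU : G.unrKer ≤ U) (hc : (G.restrict U hU).VerticialPureRamificationCount) {l k : ℕ}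
    {H' : Subgroup P} (hS : G.Sigma = {l}) (hk : 0 < k) (hle : H' ≤ U)
    (hnorm : (H'.subgroupOf U).Normal) (hopen : IsOpen (H' : Set P)) (hidx : H'.relIndex U = l ^ k)
    (hKH' : G.unrKer ≤ H') :
    G.nodeCount H' = G.nodeCount U * H'.relIndex U ∧
      (G.IsVerticiallyPurelyTotallyRamified U H' ↔
        (G.vertCount H' : ℤ) = (H'.relIndex U : ℤ) * ((G.vertCount U : ℤ) - 1) + 1) := by
  haveI : H'.FiniteIndex := by
    refine ⟨fun h0 => ?_⟩
    rw [← Subgroup.relIndex_mul_index hle, hidx] at h0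
    rcases mul_eq_zero.mp h0 with h | h
    · exact pow_ne_zero k (fun hl => by
        have := G.sigma_prime l (by rw [hS]; exact Set.mem_singleton l)
        rw [hl] at this; exact Nat.not_prime_zero this) h
    · exact Subgroup.FiniteIndex.index_ne_zero h
  have hunr : (G.restrict U hU).IsUnrCovering (H'.subgroupOf U) := by
    change (G.restrict U hU).unrKer ≤ H'.subgroupOf U
    rw [unrKer_restrict G U hU hKU]
    exact Subgroup.comap_mono hKH'
  obtain ⟨hn, hiff⟩ := hc l k (H'.subgroupOf U) (by rw [restrict_Sigma, hS]) hk hnorm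
    ((isOpen_subgroupOf_iff hU hle).mpr hopen) hidx hunr
  rw [restrict_nodeCount G U hU H' hle, restrict_graph_n] at hn
  rw [isVerticiallyPurelyTotallyRamified_restrict_iff hU hle, restrict_vertCount G U hU H' hle,
    restrict_graph_i] at hiff
  exact ⟨hn, hiff⟩

/-- **The binder `hRC` of `PSCUnrVerticialNecessityProofs` (GAP-LEDGER G-w5d174-2), DISCHARGED from
[CombGC] Rmk. 1.4.2 applied to every covering datum**: for profinite (compact) `Π_G`, if
`VerticialPureRamificationCount` holds for the datum `G_U` of every open `U ⊇ Ker(Π_G ↠ Π^unr_G)`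
(e.g. from `RamificationCountsHold Ω` and `Ω.IsOfPSCType (G.restrict U hU)`), then the level-`U`
statement holds in exactly the shape consumed there. [cite: MochizukiCombGC2007, Rmk 1.4.2 p.11] -/
theorem verticialPureRamificationCount_levels_of_restrict [CompactSpace P]
    (hc : ∀ (U : Subgroup P) [U.FiniteIndex] (hU : IsOpen (U : Set P)), G.unrKer ≤ U →
      (G.restrict U hU).VerticialPureRamificationCount) :
    ∀ (l k : ℕ) (U H' : Subgroup P), G.Sigma = {l} → 0 < k → U.Normal → IsOpen (U : Set P) →
      G.unrKer ≤ U → H' ≤ U → (H'.subgroupOf U).Normal → IsOpen (H' : Set P) →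
      H'.relIndex U = l ^ k → G.unrKer ≤ H' →
      (G.nodeCount H' = G.nodeCount U * H'.relIndex U ∧
        (G.IsVerticiallyPurelyTotallyRamified U H' ↔
          (G.vertCount H' : ℤ) = (H'.relIndex U : ℤ) * ((G.vertCount U : ℤ) - 1) + 1)) := by
  intro l k U H' hS hk _ hUo hKU hle hnorm hopen hidx hKH'
  haveI : DiscreteTopology (P ⧸ U) := QuotientGroup.discreteTopology hUo
  haveI : Finite (P ⧸ U) := finite_of_compact_of_discrete
  haveI : U.FiniteIndex := Subgroup.finiteIndex_of_finite_quotient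
  exact verticialPureRamificationCount_level_of_restrict hUo hKU (hc U hUo hKU) hS hk hle hnorm hopen
    hidx hKH'

end Rmk142

end PSCDatum

end Literature.AnabelianGeometry.SemiGraphs

end
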